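import Literature.Analysis.FluidPDE.CKNLocalRegularityRRSPressure
import HarnessLib

/-!
# Robinson–Rodrigo–Sadowski, Theorem 15.3: Step 3 of the induction, discharged

Analysis/FluidPDE file **discharging the named fact `RRS2016.step3`** of
`CKNLocalRegularityRRS.lean` (J. C. Robinson, J. L. Rodrigo, W. Sadowski, *The Three-Dimensional
Navier–Stokes Equations*, CUP 2016, proof of Thm. 15.3, Step 3, pp. 223–225: "`(B_k)`,
`2 ≤ k ≤ n`, implies `(A_n)`").

The whole Step-3 argument is already a theorem of the tree, conditionally on the local pressure
estimate: `RRS2016.step3_of : interpolationEstimate → lemma15_12 → step3`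
(`CKNLocalRegularityRRSStep3`: the velocity part (15.25) by the interpolation inequality,
Lemma 15.10, the pressure part (15.26) by Lemma 15.12 with `ρ = 1/2`, `r = r_n`, the tail summed
over the rings with `(B_{k-1})`), and both hypotheses are now discharged facts —
`interpolationEstimate_holds` (`CKNInterpolationEstimate`) and `RRS2016.lemma15_12_holds`
(`CKNLocalRegularityRRSPressure`, the Calderón–Zygmund local pressure estimate). This file only
records the closed discharge

* `RRS2016.step3_holds : step3`,

so that every named fact of `CKNLocalRegularityRRS.lean` (`lemma15_11`, `lemma15_12`,
`step2_force`, `step3`, `theorem15_3_force`, `theorem15_3`) is now a theorem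
(`lemma15_11_holds`, `lemma15_12_holds`, `step2_force_holds`, `step3_holds`,
`theorem15_3_force_holds`, `theorem15_3_holds`). It lives in a sibling file because
`CKNLocalRegularityRRS.lean` itself cannot import the proof files built on top of it.

Nothing else is here: no new definitions, no new named facts.

## References

* J. C. Robinson, J. L. Rodrigo, W. Sadowski, *The Three-Dimensional Navier–Stokes Equations.
  Classical Theory*, Cambridge Studies in Advanced Mathematics 157, CUP 2016, §15.3, Thm. 15.3
  and its proof (Steps 1–3), pp. 220–226, and §15.5, Lemma 15.12, p. 227, in the pagination of
  the held e-copy used throughout `CKNLocalRegularityRRS*.lean` (printed edition: §15.3 =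
  pp. 291–301, §15.5 from p. 304, by the book's table of contents). [RobinsonRodrigoSadowski2016]
-/

namespace Literature.Analysis.FluidPDE

namespace RRS2016

/-- **Step 3 of the proof of RRS Thm. 15.3, proved**: for every `C_B ≥ 1` there is
`ε₁ = ε₁(C_B) > 0` such that for every suitable pair on `Q_1(z₀)`, every `0 < ε₀ ≤ ε₁` with
`∫∫_{Q_1(z₀)} (|u|³ + |p|^{3/2}) ≤ ε₀`, every `z ∈ Q_{1/2}(z₀)` and `n ≥ 2`, the bounds `(B_k)`,
`2 ≤ k ≤ n`, imply `(A_n)`. Obtained from the tree's conditional Step 3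
(`step3_of_lemma15_12`, i.e. `step3_of interpolationEstimate_holds`) and the discharged local
pressure estimate `lemma15_12_holds` (RRS Lemma 15.12).
[cite: RobinsonRodrigoSadowski2016, §15.3, proof of Thm. 15.3, Step 3, pp. 223–225] -/
theorem step3_holds : step3 :=
  step3_of_lemma15_12 lemma15_12_holds

end RRS2016

end Literature.Analysis.FluidPDE
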